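import Summits.CriticalPhenomena.PercolationContinuityZ3.Theorems.PercNearOneGluingNoHeavyLowerTailPatternCells
import Summits.CriticalPhenomena.PercolationContinuityZ3.Theorems.PercNearOneGluingNoHeavyLowerTailRowLemmas
import Summits.CriticalPhenomena.PercolationContinuityZ3.Theorems.PercNearOneGluingNoHeavyLowerTailCertCheckSound
import HarnessLib

/-!
# `NoHeavyLowerTail` (stmt-CriticalPhenomena-4575) — certificate machine, part 2:
# connection formulas of five terminals, their cell expansions, and the row lemmas as DATA

Support file (depth prover nh-dp-blobmono gen 3; `--supports stmt-CriticalPhenomena-4575`).  Computable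
definitions + soundness; no named facts, no sorries, standard axioms.

This file connects the algebraic checker (`…CertCheck`, `…CertCheckSound`) with percolation:

* `Lit` / `Formula` — literals `v i ~ v j` / `v i ≁ v j` and DNF formulas over them; `Formula.eval m` evaluates a
  formula on a connection PATTERN `m` (`PatternCells`), `Formula.set v` is the event it denotes;
  `Formula.mem_set_iff`: on the cell of pattern `m` membership in the event is `Formula.eval m`;
* `consPatterns` — the 52 consistent patterns as an explicit list (`consPatterns_eq`); `cellsOf F` — the cells of
  an event, computed; `measureReal_set_eq_linEval`: `μ(F.set v) = Σ_{c ∈ cellsOf F} μ(Cell v c)` (the link to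
  `CertCheck.linEval`);
* `RowSpec` — the two row families of the machine as data: `ts a T O P` = `Theorems.terminalSeparation_general`
  and `kn x T O Lp P` = `RowLemmas.kn_chain`, with terminal INDICES as parameters; `RowSpec.valid` (the side
  condition "first components in `T`", decidable), `RowSpec.toRow` (the four events expanded into cells) and
  `RowSpec.holds`: a valid row spec yields the product inequality between the cell sums, for every weighted graph
  and every placement `v` of the five terminals;
* clause-unfolding lemmas (`mem_set_cons`, `holds_true`, …) for reading explicit formulas as events.
Part 3 (`…CertPositivity`) assembles certificates (`Cert`, `Cert.sound`) and removes the positivity proviso by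
weight continuity.
-/

noncomputable section

namespace Summit.CriticalPhenomena.PercolationContinuityZ3.Theorems

open MeasureTheory Set Literature.Probability.Percolation
open Literature.Probability.LatticeModels (prodBernoulli)
open scoped Classical BigOperators
open PatternCells CertCheck

namespace CertCells

variable {n : ℕ}

/-! ## Literals and formulas on five terminals -/

/-- Pair number of two distinct terminals (the `PatternCells` numbering; `10` on the diagonal). [folklore] -/
def pairIdx : Fin 5 → Fin 5 → ℕ :=
  ![![10, 0, 1, 2, 3], ![0, 10, 4, 5, 6], ![1, 4, 10, 7, 8], ![2, 5, 7, 10, 9], ![3, 6, 8, 9, 10]]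

/-- The pair number as an element of `Fin 10` (meaningful off the diagonal). [folklore] -/
def pairFin (i j : Fin 5) : Fin 10 := ⟨pairIdx i j % 10, Nat.mod_lt _ (by norm_num)⟩

/-- `pairFin` inverts `pairFst`/`pairSnd` above the diagonal. [folklore] -/
theorem pairFst_pairSnd_pairFin :
    ∀ i j : Fin 5, i < j → pairFst (pairFin i j) = i ∧ pairSnd (pairFin i j) = j := by decide

/-- Off the diagonal `pairFin` carries the pair number. [folklore] -/
theorem val_pairFin : ∀ i j : Fin 5, i ≠ j → (pairFin i j).val = pairIdx i j := by decide

/-- The pair number is symmetric. [folklore] -/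
theorem pairIdx_comm : ∀ i j : Fin 5, pairIdx i j = pairIdx j i := by decide

/-- A literal: terminals `i`, `j` and a sign (`true` = connected). [folklore] -/
abbrev Lit := Fin 5 × Fin 5 × Bool

/-- A formula in disjunctive normal form: a list of clauses, each a list (conjunction) of literals. [folklore] -/
abbrev Formula := List (List Lit)

/-- Evaluate a literal on a connection pattern. [folklore] -/
def Lit.eval (m : ℕ) (l : Lit) : Bool :=
  if l.1 = l.2.1 then l.2.2 else Nat.testBit m (pairIdx l.1 l.2.1) == l.2.2

/-- Evaluate a DNF formula on a connection pattern. [folklore] -/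
def Formula.eval (F : Formula) (m : ℕ) : Bool := F.any fun cl => cl.all (Lit.eval m)

/-- The 52 transitively consistent patterns (set partitions of five terminals), explicitly. [folklore] -/
def consPatterns : List ℕ :=
  [0, 1, 2, 4, 8, 16, 19, 20, 24, 32, 34, 37, 40, 64, 66, 68, 73, 128, 129, 134, 136, 176, 183, 184, 192, 198,
    201, 256, 257, 260, 266, 288, 293, 298, 336, 340, 347, 512, 513, 514, 524, 528, 531, 540, 608, 610, 621, 896,
    897, 910, 1008, 1023]

/-- The cells (consistent patterns) of the event of a formula, computed. [folklore] -/
def cellsOf (F : Formula) : List ℕ := consPatterns.filter F.eval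

/-- A literal holds at a configuration (for the placement `v` of the terminals). [folklore] -/
def Lit.holds (v : Fin 5 → Fin n) (l : Lit) (ω : BondConfig (Fin n)) : Prop :=
  (openGraph ω).Reachable (v l.1) (v l.2.1) ↔ l.2.2 = true

/-- The event denoted by a DNF formula. [folklore] -/
def Formula.set (v : Fin 5 → Fin n) (F : Formula) : Set (BondConfig (Fin n)) :=
  {ω | ∃ cl ∈ F, ∀ l ∈ cl, Lit.holds v l ω}

set_option maxRecDepth 100000 in
/-- The explicit list is the list of consistent patterns below `1024`. [folklore] -/
theorem consPatterns_eq : consPatterns = (List.range 1024).filter fun m => Cons5 m := by decide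

/-- On the cell of pattern `m`, the connection of two distinct terminals is the pattern bit. [folklore] -/
theorem reachable_iff_testBit (v : Fin 5 → Fin n) {m : ℕ} {ω : BondConfig (Fin n)} (hω : ω ∈ Cell v m)
    {i j : Fin 5} (hij : i ≠ j) :
    (openGraph ω).Reachable (v i) (v j) ↔ Nat.testBit m (pairIdx i j) = true := by
  rcases lt_or_gt_of_ne hij with h | h
  · obtain ⟨h1, h2⟩ := pairFst_pairSnd_pairFin i j h
    have key := hω (pairFin i j)
    rw [h1, h2, val_pairFin i j hij] at key
    exact key
  · obtain ⟨h1, h2⟩ := pairFst_pairSnd_pairFin j i h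
    have key := hω (pairFin j i)
    rw [h1, h2, val_pairFin j i (ne_of_lt h).symm.symm, ← pairIdx_comm i j] at key
    exact ⟨fun hr => key.1 hr.symm, fun hb => (key.2 hb).symm⟩

/-- On the cell of pattern `m`, a literal holds iff it evaluates to `true` on `m`. [folklore] -/
theorem Lit.holds_iff_eval (v : Fin 5 → Fin n) {m : ℕ} {ω : BondConfig (Fin n)} (hω : ω ∈ Cell v m) (l : Lit) :
    Lit.holds v l ω ↔ Lit.eval m l = true := by
  obtain ⟨i, j, b⟩ := l
  unfold Lit.holds Lit.eval
  by_cases hij : i = j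
  · subst hij
    simp
  · rw [if_neg hij, reachable_iff_testBit v hω hij]
    cases b <;> cases Nat.testBit m (pairIdx i j) <;> simp

/-- **Cells decide formulas**: on the cell of pattern `m`, `ω ∈ F.set v ↔ F.eval m`. [folklore] -/
theorem Formula.mem_set_iff (v : Fin 5 → Fin n) {m : ℕ} {ω : BondConfig (Fin n)} (hω : ω ∈ Cell v m)
    (F : Formula) : ω ∈ F.set v ↔ F.eval m = true := by
  unfold Formula.set Formula.eval
  simp only [mem_setOf_eq, List.any_eq_true, List.all_eq_true, Lit.holds_iff_eval v hω]

/-- Sums over the consistent patterns satisfying `φ`: Finset form = list form. [folklore] -/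
theorem sum_cells_eq_listSum (f : ℕ → ℝ) (φ : ℕ → Bool) :
    ∑ m ∈ (Finset.range 1024).filter (fun m => Cons5 m = true ∧ φ m = true), f m =
      ((consPatterns.filter φ).map f).sum := by
  have h1 : (Finset.range 1024).filter (fun m => Cons5 m = true ∧ φ m = true) =
      (consPatterns.filter φ).toFinset := by
    rw [consPatterns_eq, List.filter_filter, List.toFinset_filter, List.toFinset_range]
    refine Finset.filter_congr fun m _ => ?_
    simp only [Bool.and_eq_true]
    exact and_comm
  rw [h1, List.sum_toFinset]
  rw [consPatterns_eq, List.filter_filter]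
  exact List.nodup_range.filter _

/-- **Cell expansion of a formula event as a `linEval`**: `μ(F.set v) = Σ_{c ∈ cellsOf F} μ(Cell v c)`. [folklore] -/
theorem measureReal_set_eq_linEval (μ : Measure (BondConfig (Fin n))) [IsFiniteMeasure μ]
    (v : Fin 5 → Fin n) (F : Formula) :
    μ.real (F.set v) = linEval (fun m => μ.real (Cell v m)) (cellsOf F) := by
  rw [measureReal_eq_sum_cells μ v (F.set v) F.eval (fun m _ ω hω => F.mem_set_iff v hω)]
  exact sum_cells_eq_listSum _ _

/-! ## Row specifications -/

/-- The two row families of the certificate machine, with terminal indices as parameters: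
`ts a T O P` = `terminalSeparation_general` (`E = {a ~ O}`, `D = {a ≁ T}`, `Q' = {t ≁ u, (t,u) ∈ P}`):
`μ(E ∩ D) μ(D ∩ Q') ≤ μ(D) μ(E ∩ D ∩ Q')`; `kn x T O Lp P` = `RowLemmas.kn_chain`
(`Q⁺ = {t ~ u, (t,u) ∈ Lp}`): `μ(E ∩ D ∩ Q⁺) μ(D ∩ Q') ≤ μ(D ∩ Q⁺) μ(E ∩ D ∩ Q')`;
each with a monomial multiplier and a weight. [folklore] -/
inductive RowSpec where
  /-- terminal separation row -/
  | ts (a : Fin 5) (T O : List (Fin 5)) (P : List (Fin 5 × Fin 5)) (mult : List ℕ) (wt : ℕ)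
  /-- KN chain row -/
  | kn (x : Fin 5) (T O : List (Fin 5)) (Lp P : List (Fin 5 × Fin 5)) (mult : List ℕ) (wt : ℕ)
  deriving Repr

/-- Side condition of the row lemmas: guard pairs have first components in `T`. [folklore] -/
def RowSpec.valid : RowSpec → Bool
  | .ts _ T _ P _ _ => P.all fun p => decide (p.1 ∈ T)
  | .kn _ T _ Lp P _ _ => (Lp.all fun p => decide (p.1 ∈ T)) && P.all fun p => decide (p.1 ∈ T)

/-- Connection literals `a ~ u`, `u ∈ O`. [folklore] -/
def litsConn (a : Fin 5) (O : List (Fin 5)) : List Lit := O.map fun u => (a, u, true)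
/-- Separation literals `a ≁ t`, `t ∈ T`. [folklore] -/
def litsSep (a : Fin 5) (T : List (Fin 5)) : List Lit := T.map fun t => (a, t, false)
/-- Pair literals with a common sign. [folklore] -/
def litsPairs (P : List (Fin 5 × Fin 5)) (b : Bool) : List Lit := P.map fun p => (p.1, p.2, b)

/-- The four events `E₁, E₂, E₃, E₄` of a row spec (row reads `μE₁ μE₂ ≤ μE₃ μE₄`), as one-clause formulas. [folklore] -/
def RowSpec.clauses : RowSpec → List Lit × List Lit × List Lit × List Lit
  | .ts a T O P _ _ =>
    (litsConn a O ++ litsSep a T, litsSep a T ++ litsPairs P false, litsSep a T,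
      litsConn a O ++ (litsSep a T ++ litsPairs P false))
  | .kn x T O Lp P _ _ =>
    (litsConn x O ++ (litsSep x T ++ litsPairs Lp true), litsSep x T ++ litsPairs P false,
      litsSep x T ++ litsPairs Lp true, litsConn x O ++ (litsSep x T ++ litsPairs P false))

/-- Multiplier of a row spec. [folklore] -/
def RowSpec.mult : RowSpec → List ℕ
  | .ts _ _ _ _ m _ => m
  | .kn _ _ _ _ _ m _ => m

/-- Weight of a row spec. [folklore] -/
def RowSpec.wt : RowSpec → ℕ
  | .ts _ _ _ _ _ w => w
  | .kn _ _ _ _ _ _ w => w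

/-- The algebraic row of a row spec: the four events expanded into cells. [folklore] -/
def RowSpec.toRow (r : RowSpec) : Row :=
  ⟨cellsOf [r.clauses.1], cellsOf [r.clauses.2.1], cellsOf [r.clauses.2.2.1], cellsOf [r.clauses.2.2.2],
    r.mult, r.wt⟩

/-! ### The events of the clauses, in the form of the tree lemmas -/

/-- A one-clause formula denotes the conjunction of its literals. [folklore] -/
theorem mem_set_single (v : Fin 5 → Fin n) (cl : List Lit) (ω : BondConfig (Fin n)) :
    ω ∈ Formula.set v [cl] ↔ ∀ l ∈ cl, Lit.holds v l ω := by
  simp [Formula.set]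

/-- Membership in the event of a DNF formula, clause by clause (for unfolding explicit formulas). [folklore] -/
theorem mem_set_cons (v : Fin 5 → Fin n) (cl : List Lit) (F : Formula) (ω : BondConfig (Fin n)) :
    ω ∈ Formula.set v (cl :: F) ↔ (∀ l ∈ cl, Lit.holds v l ω) ∨ ω ∈ Formula.set v F := by
  simp [Formula.set]

/-- The empty formula denotes the empty event. [folklore] -/
theorem not_mem_set_nil (v : Fin 5 → Fin n) (ω : BondConfig (Fin n)) : ω ∉ Formula.set v [] := by
  simp [Formula.set]

/-- The empty conjunction. [folklore] -/
theorem forall_mem_nil_iff (p : Lit → Prop) : (∀ l ∈ ([] : List Lit), p l) ↔ True := by simp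

/-- A positive literal holds iff the two terminals are connected. [folklore] -/
theorem holds_true (v : Fin 5 → Fin n) (i j : Fin 5) (ω : BondConfig (Fin n)) :
    Lit.holds v (i, j, true) ω ↔ ω ∈ openConn (v i) (v j) := by
  simp [Lit.holds, openConn]

/-- A negative literal holds iff the two terminals are not connected. [folklore] -/
theorem holds_false (v : Fin 5 → Fin n) (i j : Fin 5) (ω : BondConfig (Fin n)) :
    Lit.holds v (i, j, false) ω ↔ ω ∉ openConn (v i) (v j) := by
  simp [Lit.holds, openConn]

/-- Connection literals denote `{a ~ O}`. [folklore] -/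
theorem forall_litsConn (v : Fin 5 → Fin n) (a : Fin 5) (O : List (Fin 5)) (ω : BondConfig (Fin n)) :
    (∀ l ∈ litsConn a O, Lit.holds v l ω) ↔ ∀ u ∈ (O.map v).toFinset, ω ∈ openConn (v a) u := by
  simp [litsConn, Lit.holds, openConn]

/-- Separation literals denote `{a ≁ T}`. [folklore] -/
theorem forall_litsSep (v : Fin 5 → Fin n) (a : Fin 5) (T : List (Fin 5)) (ω : BondConfig (Fin n)) :
    (∀ l ∈ litsSep a T, Lit.holds v l ω) ↔ ∀ t ∈ (T.map v).toFinset, ω ∉ openConn (v a) t := by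
  simp [litsSep, Lit.holds, openConn]

/-- Negative pair literals denote `{t ≁ u, (t,u) ∈ P}`. [folklore] -/
theorem forall_litsPairs_false (v : Fin 5 → Fin n) (P : List (Fin 5 × Fin 5)) (ω : BondConfig (Fin n)) :
    (∀ l ∈ litsPairs P false, Lit.holds v l ω) ↔
      ∀ p ∈ (P.map fun p => (v p.1, v p.2)).toFinset, ω ∉ openConn p.1 p.2 := by
  unfold litsPairs Lit.holds
  rw [List.forall_mem_map]
  constructor
  · intro h p hp
    obtain ⟨q, hq, rfl⟩ := List.mem_map.1 (List.mem_toFinset.1 hp)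
    have := h q hq
    simp only [Bool.false_eq_true, iff_false] at this
    exact this
  · intro h q hq
    have := h (v q.1, v q.2) (List.mem_toFinset.2 (List.mem_map.2 ⟨q, hq, rfl⟩))
    simp only [Bool.false_eq_true, iff_false]
    exact this

/-- Positive pair literals denote `{t ~ u, (t,u) ∈ P}`. [folklore] -/
theorem forall_litsPairs_true (v : Fin 5 → Fin n) (P : List (Fin 5 × Fin 5)) (ω : BondConfig (Fin n)) :
    (∀ l ∈ litsPairs P true, Lit.holds v l ω) ↔
      ∀ p ∈ (P.map fun p => (v p.1, v p.2)).toFinset, ω ∈ openConn p.1 p.2 := by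
  unfold litsPairs Lit.holds
  rw [List.forall_mem_map]
  constructor
  · intro h p hp
    obtain ⟨q, hq, rfl⟩ := List.mem_map.1 (List.mem_toFinset.1 hp)
    have := h q hq
    simp only [iff_true] at this
    exact this
  · intro h q hq
    have := h (v q.1, v q.2) (List.mem_toFinset.2 (List.mem_map.2 ⟨q, hq, rfl⟩))
    simp only [iff_true]
    exact this

/-- Image guards keep first components in the image of `T`. [folklore] -/
theorem fst_mem_image {T : List (Fin 5)} {P : List (Fin 5 × Fin 5)} (v : Fin 5 → Fin n)
    (hP : (P.all fun p => decide (p.1 ∈ T)) = true) :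
    ∀ p ∈ (P.map fun p => (v p.1, v p.2)).toFinset, p.1 ∈ (T.map v).toFinset := by
  intro p hp
  rw [List.mem_toFinset, List.mem_map] at hp
  obtain ⟨q, hq, rfl⟩ := hp
  rw [List.all_eq_true] at hP
  have := hP q hq
  rw [decide_eq_true_eq] at this
  exact List.mem_toFinset.2 (List.mem_map.2 ⟨q.1, this, rfl⟩)

/-- **Row specs are valid rows.**  For a valid row spec, every weighted graph and every placement `v` of the
five terminals, the cell sums satisfy `E₁ E₂ ≤ E₃ E₄`.
[cite: KozmaNitzan2024, Lemma 1 (p. 5); VandenbergHaggstromKahn2005, Thms. 1.3, 1.5] -/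
theorem RowSpec.holds (r : RowSpec) (hr : r.valid = true) (w : Sym2 (Fin n) → unitInterval)
    (v : Fin 5 → Fin n) :
    linEval (fun m => (prodBernoulli w).real (Cell v m)) r.toRow.e1 *
        linEval (fun m => (prodBernoulli w).real (Cell v m)) r.toRow.e2 ≤
      linEval (fun m => (prodBernoulli w).real (Cell v m)) r.toRow.e3 *
        linEval (fun m => (prodBernoulli w).real (Cell v m)) r.toRow.e4 := by
  cases r with
  | ts a T O P mult wt =>
    simp only [RowSpec.toRow, RowSpec.clauses, ← measureReal_set_eq_linEval]
    have key := terminalSeparation_general w (T.map v).toFinset (O.map v).toFinset (v a)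
      ((P.map fun p => (v p.1, v p.2)).toFinset) (fst_mem_image v hr)
    have e1 : Formula.set v [litsConn a O ++ litsSep a T] =
        {ω | ∀ u ∈ (O.map v).toFinset, ω ∈ openConn (v a) u} ∩
          {ω | ∀ t ∈ (T.map v).toFinset, ω ∉ openConn (v a) t} := by
      ext ω
      rw [mem_set_single, List.forall_mem_append, forall_litsConn, forall_litsSep]
      rfl
    have e2 : Formula.set v [litsSep a T ++ litsPairs P false] =
        {ω | ∀ t ∈ (T.map v).toFinset, ω ∉ openConn (v a) t} ∩
          {ω | ∀ p ∈ (P.map fun p => (v p.1, v p.2)).toFinset, ω ∉ openConn p.1 p.2} := by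
      ext ω
      rw [mem_set_single, List.forall_mem_append, forall_litsSep, forall_litsPairs_false]
      rfl
    have e3 : Formula.set v [litsSep a T] = {ω | ∀ t ∈ (T.map v).toFinset, ω ∉ openConn (v a) t} := by
      ext ω
      rw [mem_set_single, forall_litsSep]
      rfl
    have e4 : Formula.set v [litsConn a O ++ (litsSep a T ++ litsPairs P false)] =
        {ω | ∀ u ∈ (O.map v).toFinset, ω ∈ openConn (v a) u} ∩
          ({ω | ∀ t ∈ (T.map v).toFinset, ω ∉ openConn (v a) t} ∩
            {ω | ∀ p ∈ (P.map fun p => (v p.1, v p.2)).toFinset, ω ∉ openConn p.1 p.2}) := by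
      ext ω
      rw [mem_set_single, List.forall_mem_append, List.forall_mem_append, forall_litsConn, forall_litsSep,
        forall_litsPairs_false]
      rfl
    rw [e1, e2, e3, e4]
    exact key
  | kn x T O Lp P mult wt =>
    simp only [RowSpec.valid, Bool.and_eq_true] at hr
    simp only [RowSpec.toRow, RowSpec.clauses, ← measureReal_set_eq_linEval]
    have key := RowLemmas.kn_chain w (v x) (T.map v).toFinset (O.map v).toFinset
      ((Lp.map fun p => (v p.1, v p.2)).toFinset) (fst_mem_image v hr.1)
      ((P.map fun p => (v p.1, v p.2)).toFinset) (fst_mem_image v hr.2)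
    have e1 : Formula.set v [litsConn x O ++ (litsSep x T ++ litsPairs Lp true)] =
        {ω | ∀ u ∈ (O.map v).toFinset, ω ∈ openConn (v x) u} ∩
          {ω | ∀ t ∈ (T.map v).toFinset, ω ∉ openConn (v x) t} ∩
            {ω | ∀ p ∈ (Lp.map fun p => (v p.1, v p.2)).toFinset, ω ∈ openConn p.1 p.2} := by
      ext ω
      rw [mem_set_single, List.forall_mem_append, List.forall_mem_append, forall_litsConn, forall_litsSep,
        forall_litsPairs_true, Set.mem_inter_iff, Set.mem_inter_iff]
      simp only [mem_setOf_eq]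
      tauto
    have e2 : Formula.set v [litsSep x T ++ litsPairs P false] =
        {ω | ∀ t ∈ (T.map v).toFinset, ω ∉ openConn (v x) t} ∩
          {ω | ∀ p ∈ (P.map fun p => (v p.1, v p.2)).toFinset, ω ∉ openConn p.1 p.2} := by
      ext ω
      rw [mem_set_single, List.forall_mem_append, forall_litsSep, forall_litsPairs_false]
      rfl
    have e3 : Formula.set v [litsSep x T ++ litsPairs Lp true] =
        {ω | ∀ t ∈ (T.map v).toFinset, ω ∉ openConn (v x) t} ∩
          {ω | ∀ p ∈ (Lp.map fun p => (v p.1, v p.2)).toFinset, ω ∈ openConn p.1 p.2} := by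
      ext ω
      rw [mem_set_single, List.forall_mem_append, forall_litsSep, forall_litsPairs_true]
      rfl
    have e4 : Formula.set v [litsConn x O ++ (litsSep x T ++ litsPairs P false)] =
        {ω | ∀ u ∈ (O.map v).toFinset, ω ∈ openConn (v x) u} ∩
          ({ω | ∀ t ∈ (T.map v).toFinset, ω ∉ openConn (v x) t} ∩
            {ω | ∀ p ∈ (P.map fun p => (v p.1, v p.2)).toFinset, ω ∉ openConn p.1 p.2}) := by
      ext ω
      rw [mem_set_single, List.forall_mem_append, List.forall_mem_append, forall_litsConn, forall_litsSep,
        forall_litsPairs_false]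
      rfl
    rw [e1, e2, e3, e4]
    exact key

end CertCells

end Summit.CriticalPhenomena.PercolationContinuityZ3.Theorems

end
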